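import Mathlib
import HarnessLib
import Summits.HubbardSuperconductivity.HubbardSuperconductivity.Theorems.KLProgrammeKLRegimeCountertermJacksonRemainderLocal
import Summits.HubbardSuperconductivity.HubbardSuperconductivity.Theorems.KLProgrammePerturbedFermiCurveCompChain

/-!
# Route `KLProgramme`, crux K3 — gen-8 ENGINE-FLOW child (stmt-HubbardSuperconductivity-20437 `KLRegimeEngineV17F2`), stub (C)
# `stub_twoLeg_curvature`: the (C1) JACKSON-REMAINDER DOOR, part 2 — jets `k ≤ 4` of `θ ↦ (F − 𝒥_d F)(γ(θ))` along a `C⁴` curve (generic chart)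

Seat hubbard-kl-k3c3-p1 (g5).  (C1) of c4a-1's decomposition (KL STATUS 2026-08-27 l.2674/2731) is `f_{n−1} − (klFlowPiece (n−1))∘γ_{K_n} =
−[jhigh1 d (klFrameExtFn μ f_{n−1})]∘γ_{K_n}` (`d = klFlowDeg (n−1)`; the flat-tube extension satisfies `E_μ f ∘ γ = f`).  From part 1
(`…JacksonRemainderLocal`: the remainder's derivatives at the curve point from LOCAL sizes `Ml` on the `r`-ball, GLOBAL sizes `B`, margin `δ`) and
k3c3-p3's structured chain rule (`…PerturbedFermiCurveCompChain`, Stirling weights `1 | 1,1 | 1,3,1 | 1,6,7,1`) with HONEST curve jets `‖γ^{(i)}(θ)‖ ≤ Dⁱ`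
(c4a-1 l.2734 — not the `klCurveT` towers):

* `(π ^ 3 / ((d + 1) * δ) ^ 3) = π³/((d+1)δ)³`, the size table `(fun l : ℕ => if l = 4 then 2 * Ml 4 + B 4 * (π ^ 3 / ((d + 1) * δ) ^ 3) else Ml (l + 1) * m₁ + (B l + Ml l) * (π ^ 3 / ((d + 1) * δ) ^ 3))` (`Q l = Ml (l+1)·3π/(d+1) + (B l + Ml l)·τ` for `l ≤ 3`, `Q 4 = 2·Ml 4 + B 4·τ`);
* `contDiff_jhigh1_comp_curve` (`C⁴`), `abs_jhigh1_curve_le` (value), **`jacksonRemainder_curve_jets`**: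
  `|R′| ≤ Q 1·D`, `|R″| ≤ (Q 2 + Q 1)·D²`, `|R‴| ≤ (Q 3 + 3Q 2 + Q 1)·D³`, `|R⁗| ≤ (Q 4 + 6Q 3 + 7Q 2 + Q 1)·D⁴`;
* §4 presentation on symmetric frames: `(jacksonFrame d F).eval − F = −jhigh1 d F` (J1), `jacksonFrame_curve_sub_eq`, `abs_iteratedDeriv_neg_fun`.

The TOP order is the generic chart's `2·Ml 4·D⁴` (honest `D/ρ ≈ 1.1–1.4` on klWindowC); the co-moving refinement `2·sup|f⁗| + O(1/d)` (c4a-1's chart) is not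
attempted here.  Pure real analysis; no definitions; nothing about the model; nothing here asserts superconductivity.
-/

noncomputable section

namespace Summit.HubbardSuperconductivity.HubbardSuperconductivity.Theorems.KLRegimeSplit

set_option linter.dupNamespace false -- summit = problem name (single-conjunct summit), D-0017

open Real MeasureTheory Filter
open Literature.Analysis.Fourier.TrigApprox Literature.MathematicalPhysics.QuantumLattice
open Summit.HubbardSuperconductivity.HubbardSuperconductivity.Theorems.PerturbedFermiCurve

/-! ## §3 The door: jets of the remainder along a `C⁴` curve -/

section Door

variable {F : (Fin 2 → ℝ) → ℝ} {B : ℕ → ℝ} {γ : ℝ → EuclideanSpace ℝ (Fin 2)} {θ r : ℝ} {Ml : ℕ → ℝ} {δ D : ℝ}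

/-- The remainder read through `EuclideanSpace` is `C⁴`. -/
theorem contDiff_jhigh1_onM (d : ℕ) (hF : Continuous F)
    (hG : ContDiff ℝ 4 (fun q : EuclideanSpace ℝ (Fin 2) => F (WithLp.ofLp q)))
    (hB : ∀ i ≤ 4, ∀ y, ‖iteratedFDeriv ℝ i (fun q : EuclideanSpace ℝ (Fin 2) => F (WithLp.ofLp q)) y‖ ≤ B i) :
    ContDiff ℝ 4 (fun q : EuclideanSpace ℝ (Fin 2) => jhigh1 d F (WithLp.ofLp q)) :=
  (jhigh1_package d hF hG hB).2.1

/-- **The remainder along the curve is `C⁴`** (the regularity conjunct of `TwoLegReadJetBound`-type predicates). -/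
theorem contDiff_jhigh1_comp_curve (d : ℕ) (hF : Continuous F)
    (hG : ContDiff ℝ 4 (fun q : EuclideanSpace ℝ (Fin 2) => F (WithLp.ofLp q)))
    (hB : ∀ i ≤ 4, ∀ y, ‖iteratedFDeriv ℝ i (fun q : EuclideanSpace ℝ (Fin 2) => F (WithLp.ofLp q)) y‖ ≤ B i)
    (hγ : ContDiff ℝ 4 γ) :
    ContDiff ℝ 4 ((fun q : EuclideanSpace ℝ (Fin 2) => jhigh1 d F (WithLp.ofLp q)) ∘ γ) :=
  (contDiff_jhigh1_onM d hF hG hB).comp hγ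

/-- The size table bounds the remainder's derivatives at the curve point, orders `1 … 4`. -/
theorem norm_iteratedFDeriv_jhigh1_le_table (d : ℕ) (hF : Continuous F)
    (hG : ContDiff ℝ 4 (fun q : EuclideanSpace ℝ (Fin 2) => F (WithLp.ofLp q)))
    (hB : ∀ i ≤ 4, ∀ y, ‖iteratedFDeriv ℝ i (fun q : EuclideanSpace ℝ (Fin 2) => F (WithLp.ofLp q)) y‖ ≤ B i)
    (hMl : ∀ i ≤ 4, ∀ y : EuclideanSpace ℝ (Fin 2), ‖y - γ θ‖ ≤ r →
      ‖iteratedFDeriv ℝ i (fun q : EuclideanSpace ℝ (Fin 2) => F (WithLp.ofLp q)) y‖ ≤ Ml i)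
    (hδ : 0 < δ) (hδπ : δ ≤ π) (hδr : 2 * δ ≤ r) {m₁ : ℝ} (hm₁ : ∫ w, jweight d w * (|w.1| + |w.2|) ∂jmeas ≤ m₁)
    {l : ℕ} (hl1 : 1 ≤ l) (hl4 : l ≤ 4) :
    ‖iteratedFDeriv ℝ l (fun q : EuclideanSpace ℝ (Fin 2) => jhigh1 d F (WithLp.ofLp q)) (γ θ)‖ ≤
      (fun l : ℕ => if l = 4 then 2 * Ml 4 + B 4 * (π ^ 3 / ((d + 1) * δ) ^ 3)
        else Ml (l + 1) * m₁ + (B l + Ml l) * (π ^ 3 / ((d + 1) * δ) ^ 3)) l := by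
  beta_reduce
  by_cases h4 : l = 4
  · subst h4; rw [if_pos rfl]
    exact norm_iteratedFDeriv_jhigh1_le_local_top d hF hG hB hMl hδ hδπ hδr le_rfl
  · rw [if_neg h4]
    have hl3 : l + 1 ≤ 4 := by omega
    exact norm_iteratedFDeriv_jhigh1_le_local d hF hG hB hMl hδ hδπ hδr hm₁ hl3

/-- **The VALUE of the remainder at the curve point**: `|F(γθ) − 𝒥_dF(γθ)| ≤ Ml 1·m₁ + (B 0 + Ml 0)·τ`. -/
theorem abs_jhigh1_curve_le (d : ℕ) (hF : Continuous F)
    (hG : ContDiff ℝ 4 (fun q : EuclideanSpace ℝ (Fin 2) => F (WithLp.ofLp q)))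
    (hB : ∀ i ≤ 4, ∀ y, ‖iteratedFDeriv ℝ i (fun q : EuclideanSpace ℝ (Fin 2) => F (WithLp.ofLp q)) y‖ ≤ B i)
    (hMl : ∀ i ≤ 4, ∀ y : EuclideanSpace ℝ (Fin 2), ‖y - γ θ‖ ≤ r →
      ‖iteratedFDeriv ℝ i (fun q : EuclideanSpace ℝ (Fin 2) => F (WithLp.ofLp q)) y‖ ≤ Ml i)
    (hδ : 0 < δ) (hδπ : δ ≤ π) (hδr : 2 * δ ≤ r) {m₁ : ℝ} (hm₁ : ∫ w, jweight d w * (|w.1| + |w.2|) ∂jmeas ≤ m₁) :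
    |jhigh1 d F (WithLp.ofLp (γ θ))| ≤ Ml 1 * m₁ + (B 0 + Ml 0) * (π ^ 3 / ((d + 1) * δ) ^ 3) := by
  have h := norm_iteratedFDeriv_jhigh1_le_local d hF hG hB hMl hδ hδπ hδr hm₁ (j := 0) (by norm_num)
  rw [norm_iteratedFDeriv_zero, Real.norm_eq_abs] at h
  exact h

/-- **THE (C1) DOOR — jets of the Jackson remainder along the curve.**  With `R := (F − 𝒥_d F) ∘ ofLp ∘ γ`, local symbol sizes `Ml` on the
`r`-ball about `γ θ` (`2δ ≤ r`), global sizes `B`, curve sizes `‖γ^{(i)}(θ)‖ ≤ Dⁱ`, any first-moment bound `∫J̃J̃(|s|+|t|) ≤ m₁`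
(`3π/(d+1)`: `integral_jweight_mul_absSum_le_threePi`; `π√3/(d+1)`: k3c3-p3's `…JacksonSharpMoments`), `τ := π³/((d+1)δ)³` (far mass) and
`Q₁ = Ml 2·m₁ + (B 1 + Ml 1)τ`, `Q₂ = Ml 3·m₁ + (B 2 + Ml 2)τ`, `Q₃ = Ml 4·m₁ + (B 3 + Ml 3)τ`, `Q₄ = 2·Ml 4 + B 4·τ`:
`|R′(θ)| ≤ Q₁D`, `|R″| ≤ (Q₂ + Q₁)D²`, `|R‴| ≤ (Q₃ + 3Q₂ + Q₁)D³`, `|R⁗| ≤ (Q₄ + 6Q₃ + 7Q₂ + Q₁)D⁴`. -/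
theorem jacksonRemainder_curve_jets (d : ℕ) (hF : Continuous F)
    (hG : ContDiff ℝ 4 (fun q : EuclideanSpace ℝ (Fin 2) => F (WithLp.ofLp q)))
    (hB : ∀ i ≤ 4, ∀ y, ‖iteratedFDeriv ℝ i (fun q : EuclideanSpace ℝ (Fin 2) => F (WithLp.ofLp q)) y‖ ≤ B i)
    (hγ : ContDiff ℝ 4 γ)
    (hMl : ∀ i ≤ 4, ∀ y : EuclideanSpace ℝ (Fin 2), ‖y - γ θ‖ ≤ r →
      ‖iteratedFDeriv ℝ i (fun q : EuclideanSpace ℝ (Fin 2) => F (WithLp.ofLp q)) y‖ ≤ Ml i)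
    (hδ : 0 < δ) (hδπ : δ ≤ π) (hδr : 2 * δ ≤ r) {m₁ : ℝ} (hm₁ : ∫ w, jweight d w * (|w.1| + |w.2|) ∂jmeas ≤ m₁)
    (hD : ∀ i, 1 ≤ i → i ≤ 4 → ‖iteratedDeriv i γ θ‖ ≤ D ^ i) :
    |iteratedDeriv 1 ((fun q : EuclideanSpace ℝ (Fin 2) => jhigh1 d F (WithLp.ofLp q)) ∘ γ) θ| ≤
      (Ml 2 * m₁ + (B 1 + Ml 1) * (π ^ 3 / ((d + 1) * δ) ^ 3)) * D ∧
    |iteratedDeriv 2 ((fun q : EuclideanSpace ℝ (Fin 2) => jhigh1 d F (WithLp.ofLp q)) ∘ γ) θ| ≤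
      ((Ml 3 * m₁ + (B 2 + Ml 2) * (π ^ 3 / ((d + 1) * δ) ^ 3)) +
        (Ml 2 * m₁ + (B 1 + Ml 1) * (π ^ 3 / ((d + 1) * δ) ^ 3))) * D ^ 2 ∧
    |iteratedDeriv 3 ((fun q : EuclideanSpace ℝ (Fin 2) => jhigh1 d F (WithLp.ofLp q)) ∘ γ) θ| ≤
      ((Ml 4 * m₁ + (B 3 + Ml 3) * (π ^ 3 / ((d + 1) * δ) ^ 3)) +
        3 * (Ml 3 * m₁ + (B 2 + Ml 2) * (π ^ 3 / ((d + 1) * δ) ^ 3)) +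
        (Ml 2 * m₁ + (B 1 + Ml 1) * (π ^ 3 / ((d + 1) * δ) ^ 3))) * D ^ 3 ∧
    |iteratedDeriv 4 ((fun q : EuclideanSpace ℝ (Fin 2) => jhigh1 d F (WithLp.ofLp q)) ∘ γ) θ| ≤
      ((2 * Ml 4 + B 4 * (π ^ 3 / ((d + 1) * δ) ^ 3)) +
        6 * (Ml 4 * m₁ + (B 3 + Ml 3) * (π ^ 3 / ((d + 1) * δ) ^ 3)) +
        7 * (Ml 3 * m₁ + (B 2 + Ml 2) * (π ^ 3 / ((d + 1) * δ) ^ 3)) +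
        (Ml 2 * m₁ + (B 1 + Ml 1) * (π ^ 3 / ((d + 1) * δ) ^ 3))) * D ^ 4 := by
  obtain ⟨h1, h2, h3, h4⟩ := abs_iteratedDeriv_comp_le_stirling (contDiff_jhigh1_onM d hF hG hB) hγ
    (fun _ hk1 hk4 => norm_iteratedFDeriv_jhigh1_le_table d hF hG hB hMl hδ hδπ hδr hm₁ hk1 hk4) hD
  exact ⟨h1, h2, h3, h4⟩

end Door

/-! ## §4 Presentation on symmetric frames: `(jacksonFrame d F).eval − F = −jhigh1 d F` -/

section Frame

variable (d : ℕ) {F : (Fin 2 → ℝ) → ℝ}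

/-- On a symmetric frame the Jackson-mean FRAME's value minus the function is minus the remainder (J1 `eval_jacksonFrame`). -/
theorem eval_jacksonFrame_sub_eq_neg_jhigh1 (hc : Continuous F)
    (hper : ∀ (p : Fin 2 → ℝ) (z : Fin 2 → ℤ), F (fun i => p i + z i * (2 * π)) = F p)
    (hrefl : ∀ p : Fin 2 → ℝ, F ![p 0, -p 1] = F p) (hswap : ∀ p : Fin 2 → ℝ, F ![p 1, p 0] = F p) (p : Fin 2 → ℝ) :
    (jacksonFrame d F).eval p - F p = -jhigh1 d F p := by
  rw [eval_jacksonFrame hc hper hrefl hswap d p, jhigh1]; ring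

/-- **The (C1) object of stub (C)**: along any curve `γ` on which `F∘ofLp∘γ = f` (the flat tube: `E_μ f ∘ γ_K = f`), the function
`θ ↦ (jacksonFrame d F).eval (ofLp (γ θ)) − f θ` IS `−(jhigh1 d F ∘ ofLp ∘ γ)` — so its jets are those of §3 (`iteratedDeriv_neg`, `abs_neg`). -/
theorem jacksonFrame_curve_sub_eq (hc : Continuous F)
    (hper : ∀ (p : Fin 2 → ℝ) (z : Fin 2 → ℤ), F (fun i => p i + z i * (2 * π)) = F p)
    (hrefl : ∀ p : Fin 2 → ℝ, F ![p 0, -p 1] = F p) (hswap : ∀ p : Fin 2 → ℝ, F ![p 1, p 0] = F p)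
    {γ : ℝ → EuclideanSpace ℝ (Fin 2)} {f : ℝ → ℝ} (hon : ∀ θ, F (WithLp.ofLp (γ θ)) = f θ) :
    (fun θ => (jacksonFrame d F).eval (WithLp.ofLp (γ θ)) - f θ) =
      fun θ => -(((fun q : EuclideanSpace ℝ (Fin 2) => jhigh1 d F (WithLp.ofLp q)) ∘ γ) θ) := by
  funext θ
  rw [← hon θ, eval_jacksonFrame_sub_eq_neg_jhigh1 d hc hper hrefl hswap]
  rfl

/-- Jets of a negated function: `|∂ᵏ(−R)| = |∂ᵏR|`. -/
theorem abs_iteratedDeriv_neg_fun (R : ℝ → ℝ) (k : ℕ) (θ : ℝ) :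
    |iteratedDeriv k (fun ϑ => -R ϑ) θ| = |iteratedDeriv k R θ| := by
  rw [show (fun ϑ => -R ϑ) = -R from rfl, iteratedDeriv_neg, abs_neg]

end Frame

end Summit.HubbardSuperconductivity.HubbardSuperconductivity.Theorems.KLRegimeSplit

end
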